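import Mathlib
import Summits.ValiantsHypothesis.ValiantsHypothesis.Theses.AlgebraicKWGames
import Summits.ValiantsHypothesis.ValiantsHypothesis.Theorems.AlgebraicKWGamesOneAlternationLowerBoundCount

/-!
# `OneAlternationLowerBound` (item stmt-ValiantsHypothesis-10302) — proved

Route `AlgebraicKWGames`, support item Δ = 1 ("one-round protocols", in the weaker polylog form the route
needs): for every `c` there is `n ≥ 2` such that no zero-test algebraic protocol of depth
`c·(⌊log₂ n⌋+1)²` in which Alice speaks for a block of rounds and then only Bob speaks solves the
KW game of `per_n` over `ℂ`.

Proof (files `…OneAlternationLowerBoundRun/Generic/Count`): a transcendence-degree adversary.  On the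
subspace `{y_e = x_e : e ∈ E}` of input pairs, the generic transcript is a sequence of polynomials; by
`MvPolynomial.funext` correctness forces the generic output cell `e` to lie outside `E` and the
identification `y_e ↦ x_e` to kill a nonzero Bob message, which makes `x_e` algebraic over Alice's
`≤ T` messages (the free `y`'s drop out by matroid exchange).  Since the `x_e` are algebraically
independent, at most `T` cells can be absorbed, while the adversary absorbs `T + 1` of them as soon as
`T + 2 ≤ n²`; we take `n = 2^(c+3)`.

Honest framing: a lower bound in a toy communication model with one alternation, the calibration rung
of a dormant route; it says nothing about VP versus VNP (which is NOT proved).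
-/

-- the summit and the problem share the name `ValiantsHypothesis` (D-0017 single-conjunct layout)
set_option linter.dupNamespace false

namespace Summit.ValiantsHypothesis.ValiantsHypothesis.Theorems.AlgebraicKWGames

open OneAlt

/-- Arithmetic: `(c+4)³ ≤ 4^(c+3)`. -/
theorem pow_three_le_four_pow (c : ℕ) : (c + 4) ^ 3 ≤ 4 ^ (c + 3) := by
  induction c with
  | zero => norm_num
  | succ c ih =>
    have h1 : (c + 1 + 4) ^ 3 ≤ 4 * (c + 4) ^ 3 := by
      have : (c + 5) ^ 3 ≤ 4 * (c + 4) ^ 3 := by nlinarith [Nat.zero_le c, sq_nonneg (c : ℤ)]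
      simpa [add_assoc] using this
    calc (c + 1 + 4) ^ 3 ≤ 4 * (c + 4) ^ 3 := h1
      _ ≤ 4 * 4 ^ (c + 3) := Nat.mul_le_mul_left 4 ih
      _ = 4 ^ (c + 1 + 3) := by ring

/-- The depth budget `c·(c+4)²` plus two spare cells fits into the `2^(c+3) × 2^(c+3)` matrix. -/
theorem depth_budget (c : ℕ) : c * (c + 3 + 1) ^ 2 + 2 ≤ 2 ^ (c + 3) * 2 ^ (c + 3) := by
  have h1 : c * (c + 3 + 1) ^ 2 + 2 ≤ (c + 4) ^ 3 := by nlinarith [Nat.zero_le c]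
  have h2 : 4 ^ (c + 3) = 2 ^ (c + 3) * 2 ^ (c + 3) := by
    rw [← mul_pow]
    norm_num
  calc c * (c + 3 + 1) ^ 2 + 2 ≤ (c + 4) ^ 3 := h1
    _ ≤ 4 ^ (c + 3) := pow_three_le_four_pow c
    _ = 2 ^ (c + 3) * 2 ^ (c + 3) := h2

/-- **Item stmt-ValiantsHypothesis-10302 (`OneAlternationLowerBound`), proved.**  For every `c`
there is `n ≥ 2` (namely `n = 2^(c+3)`) such that no zero-test algebraic protocol of depth
`c·(⌊log₂ n⌋+1)²` with a monotone block schedule of at most one alternation (Alice's block, then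
Bob's) solves the Karchmer–Wigderson game of `per_n` over `ℂ`. -/
theorem oneAlternationLowerBound_proof :
    Summit.ValiantsHypothesis.ValiantsHypothesis.Theses.AlgebraicKWGames.OneAlternationLowerBound := by
  intro c
  refine ⟨2 ^ (c + 3), ?_, ?_⟩
  · calc 2 = 2 ^ 1 := by norm_num
      _ ≤ 2 ^ (c + 3) := Nat.pow_le_pow_right (by norm_num) (by omega)
  · rintro ⟨blk, msg, out, hmono, hle, hcorr⟩
    have hlog : Nat.log 2 (2 ^ (c + 3)) = c + 3 := Nat.log_pow (by norm_num) _
    let P : Protocol (2 ^ (c + 3)) (c * (Nat.log 2 (2 ^ (c + 3)) + 1) ^ 2) :=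
      { blk := blk, msg := msg, out := out, mono := hmono, le_one := hle, correct := hcorr }
    refine P.false ?_
    rw [Fintype.card_prod, Fintype.card_fin, hlog]
    exact depth_budget c

end Summit.ValiantsHypothesis.ValiantsHypothesis.Theorems.AlgebraicKWGames
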